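import Summits.BirchSwinnertonDyer.Rank1Residual.GaloisImage.SelmerStructureTransportDual
import Summits.BirchSwinnertonDyer.BirchSwinnertonDyer.Theorems.SchneiderFreeAdditiveX3PoitouTateReciprocitySumHolds
import HarnessLib

/-!
# Crux `PrintCf2.SplitBadTwoRankOneOfFacts` (stmt-BirchSwinnertonDyer-20368), skeleton v13.1, stub S3n′ `stub_pseudoNullFinite_two`,
# S3N-FACTFREE brick R2 (-w2 g14 memo §4/§7), file 1: THE LEVEL-LIFTING SURGERY WITH A PRO-NULL DUAL —
# Poitou–Tate surgery for test classes pushed forward from a lower level, the obstruction killed by the VANISHING OF THE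
# DUAL PULLBACK (no Weil transport, no finiteness, no `E`)

Cell `bsd-print-cf2`, WIDTH seat `bsd-line-cf2-p1-w5` g7 (prover-bsd-line-cf2-p1-w5-g7-0); `--supports stmt-BirchSwinnertonDyer-20368`
(helper, Theses-free). HONEST FRAMING: nothing here closes the crux or a registered stub; BSD is not proved by any of this; no summit
statement is proved by this seat. No definition, no named fact, no `sorry`. Unconditional (the Poitou–Tate input is the tree's THEOREM
`selmerComplement_canonical_holds` for THE canonical local invariant maps; the abstract versions take a family `inv` as a parameter).

WHAT. X11b's `levelLiftingP_of_finite` (JSW17 Prop. 3.3.2 in the kernel) realises prescribed local classes of `E[p^{K₀}]` by a global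
Selmer class of `E[p^N]`, `N = K₀ + e`, killing the Poitou–Tate obstruction `∑_v ⟨ι_* s_v, y_v⟩_v` by `⟨ι_* s, y⟩ = ⟨s, π_* ỹ⟩` (Weil
transport `ỹ`) and `π_* ỹ = 0` (finiteness of Castella's relaxed group). The S3N-FACTFREE road (-w2 g14) needs the same surgery for the
CHARACTER levels `A_θ[p^k] ↪ A_θ[p^m]`, where no Weil transport is available but none is needed: the dual tower of
`M_k = (ℤ/p^k)(θ)` is the `μ`-tower, and «`π_* y = 0` on the dual Selmer group» is (PRO-NULL) ⟸ (R1) = Leopoldt-at-`v` (p696581).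
THIS FILE is the generic engine, for ANY two finite discrete `Γ_K`-modules `M₀ →ι M` killed by `n` over ANY number field `K`:

* §1 `sum_localTatePairingZMod_localMap_eq_zero` — the obstruction of a pushed-forward family `t_v = H¹(ι_v) s_v` against `y` is
  `∑_{v∈S} ⟨s_v, H¹(ι^D_v) y_v⟩_v` (adjointness `⟨H¹(ι) s, y⟩_v = ⟨s, H¹(ι^D) y⟩_v`, the tree's `localTatePairingZMod_localMap_left` for
  the dual map `ι^D = tateDualComap ι : M^D → M₀^D`, `f ↦ f ∘ ι`), hence ZERO as soon as `H¹(ι^D_v)(loc_v y) = 0` on `S`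
  (`…_of_forall_localMap_tateDualComap_eq_zero`) — in particular when `H¹(ι^D) y = 0` globally (`localization_map_one_eq`).
* §2 **`exists_selmer_sub_localMap_mem_of_dualPullback_eq_zero`** — for a family `inv` with `SelmerComplement`, Selmer structures
  `𝓕 ≤ 𝓖` on `M` unramified outside `S ⊇ {v ∣ ∞} ∪ {v ∣ n} ∪ Ram(M)`, local classes `s_v ∈ H¹(K_v, M₀)` with `H¹(ι_v) s_v ∈ 𝓖_v`
  (`v ∈ S`): IF `H¹(ι^D)` KILLS THE DUAL SELMER GROUP `H¹_{𝓕^*}(K, M^D)` (locally on `S` suffices), THEN some `x ∈ H¹_𝓖(K, M)` has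
  `loc_v x − H¹(ι_v) s_v ∈ 𝓕_v` for all `v ∈ S`. One-place form `…_single` (targets at `v₀`, `loc_v x ∈ 𝓕_v` at the other `v ∈ S`).
* §3 the same for THE canonical family (`LocalInvariants.canonical K n`, `selmerComplement_canonical_holds`):
  **`exists_selmer_sub_localMap_mem_canonical_of_dualPullback_eq_zero`** — hypothesis-free in `inv`.
Two LEVELS `k ≤ m` of one tower are the case `M₀ = A[p^k]`, `M = A[p^m]`, `n = p^m`, `ι` the inclusion: both Tate duals are taken at the
SAME modulus `n` (`Hom(A[p^k], μ_{p^m}) = Hom(A[p^k], μ_{p^k})`), so ONE family of invariant maps serves both levels and no compatibility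
of pairings across moduli is needed (the point of -w2 g14 memo §2).
presearch: JSW17 Prop. 3.3.2 (arXiv:1512.06894 p. 11); Greenberg, Kyoto J. Math. 50 (2010) Prop. 3.2.1 (finite-level lift, the tree's
`SurLambda.exists_phi_eq_of_level` is the same device in Greenberg's arena); MR04 Thm. 2.3.4; no new fact. beyond-print theorem: no.

References: [JetchevSkinnerWan2017] Prop. 3.3.2; [Greenberg2010] Prop. 3.2.1; [Howard2004HeegnerKolyvagin] Thm. 2.1.11;
[MilneADT2006] I Thm. 4.10 (b), I §2; [NeukirchSchmidtWingberg2008] (1.4.2).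
-/

noncomputable section

open scoped Classical

set_option linter.dupNamespace false
set_option autoImplicit false

open NumberField IsDedekindDomain Field
open Literature.NumberTheory.GaloisRepresentations
open Literature.NumberTheory.GaloisRepresentations.DiscreteGaloisModule
open Literature.NumberTheory.GaloisCohomology
open Summit.BirchSwinnertonDyer.Rank1Residual.GaloisImage.Transport (tateDualComap tateDualComap_apply_apply
  localTatePairingZMod_localMap_left)
open Summit.BirchSwinnertonDyer.Rank1Residual.GaloisImage.CoreRankZero (localization_map_one_eq)
open Summit.BirchSwinnertonDyer.BirchSwinnertonDyer.Theorems.SchneiderFreeAdditiveX3.PoitouTateReduction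
  (selmerComplement_canonical_holds)
open scoped ContRepresentation

namespace Summit.BirchSwinnertonDyer.BirchSwinnertonDyer.Theorems.PrintCf2.ProNullLift

universe u

/-! ## §1. The obstruction of a pushed-forward family is the obstruction against the dual pullback -/

section Obstruction

variable {K : Type u} [Field K] [NumberField K] {M₀ M : Type u}
  [AddCommGroup M₀] [TopologicalSpace M₀] [DiscreteTopology M₀] [Finite M₀]
  [AddCommGroup M] [TopologicalSpace M] [DiscreteTopology M] [Finite M]
  {ρ₀ : DiscreteGaloisModule K M₀} {ρ : DiscreteGaloisModule K M} {n : ℕ}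
  (ι : ρ₀.toContRepresentation →ⁱL ρ.toContRepresentation)

/-- **`∑_{v∈S} ⟨H¹(ι_v) s_v, y_v⟩_v = ∑_{v∈S} ⟨s_v, H¹(ι^D_v) y_v⟩_v`** for any family of local invariant maps: the Poitou–Tate
obstruction of a family pushed forward along `ι : M₀ → M` is the obstruction of the original family against the DUAL PULLBACK
`ι^D = tateDualComap ι : M^D → M₀^D` (termwise adjointness of the cup product, `localTatePairingZMod_localMap_left`).
[cite: NeukirchSchmidtWingberg2008, I §4 (1.4.2)] [cite: JetchevSkinnerWan2017, Prop. 3.3.2 (arXiv:1512.06894 p. 11)] -/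
theorem sum_localTatePairingZMod_localMap_eq (inv : LocalInvariants K n) (S : Finset (Place K))
    (s : Π v : Place K, galoisCohomology (ρ₀.toLocal v) 1)
    (y : Π v : Place K, galoisCohomology ((ρ.tateDual n).toLocal v) 1) :
    ∑ v ∈ S, localTatePairingZMod ρ n v (inv v) (localMap ι v (s v)) (y v) =
      ∑ v ∈ S, localTatePairingZMod ρ₀ n v (inv v) (s v) (localMap (tateDualComap ι) v (y v)) :=
  Finset.sum_congr rfl fun v _ ↦
    localTatePairingZMod_localMap_left ι (tateDualComap ι) (fun _ _ ↦ rfl) v (inv v) (s v) (y v)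

/-- **The obstruction vanishes when the dual pullback vanishes locally on `S`**: if `H¹(ι^D_v) y_v = 0` for every `v ∈ S` then
`∑_{v∈S} ⟨H¹(ι_v) s_v, y_v⟩_v = 0`. [cite: JetchevSkinnerWan2017, Prop. 3.3.2 (arXiv:1512.06894 p. 11)] -/
theorem sum_localTatePairingZMod_localMap_eq_zero_of_forall_localMap_tateDualComap_eq_zero (inv : LocalInvariants K n)
    (S : Finset (Place K)) (s : Π v : Place K, galoisCohomology (ρ₀.toLocal v) 1)
    (y : Π v : Place K, galoisCohomology ((ρ.tateDual n).toLocal v) 1)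
    (hy : ∀ v ∈ S, localMap (tateDualComap ι) v (y v) = 0) :
    ∑ v ∈ S, localTatePairingZMod ρ n v (inv v) (localMap ι v (s v)) (y v) = 0 := by
  rw [sum_localTatePairingZMod_localMap_eq ι inv S s y]
  exact Finset.sum_eq_zero fun v hv ↦ by rw [hy v hv, map_zero]

/-- **Global form**: if `H¹(ι^D) y = 0` in `H¹(K, M₀^D)` then `∑_{v∈S} ⟨H¹(ι_v) s_v, loc_v y⟩_v = 0` (localisation commutes with
`H¹(ι^D)`). [cite: JetchevSkinnerWan2017, Prop. 3.3.2 (arXiv:1512.06894 p. 11)] -/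
theorem sum_localTatePairingZMod_localMap_localization_eq_zero_of_map_tateDualComap_eq_zero (inv : LocalInvariants K n)
    (S : Finset (Place K)) (s : Π v : Place K, galoisCohomology (ρ₀.toLocal v) 1)
    (y : galoisCohomology (ρ.tateDual n) 1) (hy : galoisCohomology.map (tateDualComap ι) 1 y = 0) :
    ∑ v ∈ S, localTatePairingZMod ρ n v (inv v) (localMap ι v (s v))
      (galoisCohomology.localization (ρ.tateDual n) v 1 y) = 0 := by
  refine sum_localTatePairingZMod_localMap_eq_zero_of_forall_localMap_tateDualComap_eq_zero ι inv S s _ fun v _ ↦ ?_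
  change galoisCohomology.map ((tateDualComap ι).restrictField (Place.Completion v)) 1
    (galoisCohomology.localization (ρ.tateDual n) v 1 y) = 0
  rw [← localization_map_one_eq, hy]
  exact map_zero _

end Obstruction

/-! ## §2. The surgery: local classes pushed forward from `M₀` are realised by a Selmer class of `M`, modulo `𝓕`,
as soon as `H¹(ι^D)` kills the dual Selmer group -/

section Surgery

variable {K : Type u} [Field K] [NumberField K] {M₀ M : Type u}
  [AddCommGroup M₀] [TopologicalSpace M₀] [DiscreteTopology M₀] [Finite M₀]
  [AddCommGroup M] [TopologicalSpace M] [DiscreteTopology M] [Finite M]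
  (ρ₀ : DiscreteGaloisModule K M₀) (ρ : DiscreteGaloisModule K M) {n : ℕ}
  (ι : ρ₀.toContRepresentation →ⁱL ρ.toContRepresentation)

/-- **THE LEVEL-LIFTING SURGERY WITH A PRO-NULL DUAL (local-kill form).** Let `inv` be a family of local invariant maps with
Howard's Poitou–Tate property `SelmerComplement`, `M₀ →ι M` finite discrete `Γ_K`-modules with `n • M = 0`, `S` a finite set of
places off which `n` is invertible and `M` unramified, `𝓕 ≤ 𝓖` Selmer structures on `M` unramified outside `S`, and
`s_v ∈ H¹(K_v, M₀)` local classes with `H¹(ι_v) s_v ∈ 𝓖_v` (`v ∈ S`). If for every `y ∈ H¹_{𝓕^*}(K, M^D)` and every `v ∈ S` the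
dual pullback `H¹(ι^D_v)(loc_v y)` vanishes, then there is `x ∈ H¹_𝓖(K, M)` with `loc_v x − H¹(ι_v) s_v ∈ 𝓕_v` for all `v ∈ S`.
Proof: `SelmerComplement` (i) with the test family `t_v = H¹(ι_v) s_v`, the obstruction vanishing by §1.
[cite: Howard2004HeegnerKolyvagin, Thm. 2.1.11 (arXiv:1202.6340 p. 6)] [cite: JetchevSkinnerWan2017, Prop. 3.3.2 (arXiv:1512.06894 p. 11)]
[cite: Greenberg2010, Prop. 3.2.1 (p. 15)] -/
theorem exists_selmer_sub_localMap_mem_of_forall_localMap_tateDualComap_eq_zero {inv : LocalInvariants K n}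
    (hSC : inv.SelmerComplement) (hM : ∀ m : M, n • m = 0) (S : Finset (Place K))
    (hS : ∀ v : HeightOneSpectrum (𝓞 K), (Sum.inr v : Place K) ∉ S →
      ((n : ℕ) : 𝓞 K) ∉ v.asIdeal ∧ GaloisRep.IsUnramifiedAt v ρ)
    {𝓕 𝓖 : SelmerStructure ρ} (hle : 𝓕 ≤ 𝓖) (h𝓕 : 𝓕.IsUnramifiedOutside S) (h𝓖 : 𝓖.IsUnramifiedOutside S)
    (s : Π v : Place K, galoisCohomology (ρ₀.toLocal v) 1) (hs : ∀ v ∈ S, localMap ι v (s v) ∈ 𝓖 v)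
    (hkill : ∀ y ∈ (inv.dualSelmerStructure ρ 𝓕).selmerGroup, ∀ v ∈ S,
      localMap (tateDualComap ι) v (galoisCohomology.localization (ρ.tateDual n) v 1 y) = 0) :
    ∃ x ∈ 𝓖.selmerGroup, ∀ v ∈ S, galoisCohomology.localization ρ v 1 x - localMap ι v (s v) ∈ 𝓕 v :=
  (hSC ρ hM S hS 𝓕 𝓖 hle h𝓕 h𝓖).1 (fun v ↦ localMap ι v (s v)) hs fun y hy ↦
    sum_localTatePairingZMod_localMap_eq_zero_of_forall_localMap_tateDualComap_eq_zero ι inv S s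
      (fun v ↦ galoisCohomology.localization (ρ.tateDual n) v 1 y) (hkill y hy)

/-- **THE LEVEL-LIFTING SURGERY WITH A PRO-NULL DUAL (global-kill form).** As above, with the hypothesis «`H¹(ι^D) y = 0` in
`H¹(K, M₀^D)` for every `y ∈ H¹_{𝓕^*}(K, M^D)`» — for the two levels `A[p^k] ↪ A[p^m]` of a tower this is exactly (PRO-NULL): the
transition of the dual tower kills the dual Selmer group at level `m`.
[cite: JetchevSkinnerWan2017, Prop. 3.3.2 (arXiv:1512.06894 p. 11)] [cite: Greenberg2010, Prop. 3.2.1 (p. 15)] -/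
theorem exists_selmer_sub_localMap_mem_of_dualPullback_eq_zero {inv : LocalInvariants K n}
    (hSC : inv.SelmerComplement) (hM : ∀ m : M, n • m = 0) (S : Finset (Place K))
    (hS : ∀ v : HeightOneSpectrum (𝓞 K), (Sum.inr v : Place K) ∉ S →
      ((n : ℕ) : 𝓞 K) ∉ v.asIdeal ∧ GaloisRep.IsUnramifiedAt v ρ)
    {𝓕 𝓖 : SelmerStructure ρ} (hle : 𝓕 ≤ 𝓖) (h𝓕 : 𝓕.IsUnramifiedOutside S) (h𝓖 : 𝓖.IsUnramifiedOutside S)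
    (s : Π v : Place K, galoisCohomology (ρ₀.toLocal v) 1) (hs : ∀ v ∈ S, localMap ι v (s v) ∈ 𝓖 v)
    (hkill : ∀ y ∈ (inv.dualSelmerStructure ρ 𝓕).selmerGroup, galoisCohomology.map (tateDualComap ι) 1 y = 0) :
    ∃ x ∈ 𝓖.selmerGroup, ∀ v ∈ S, galoisCohomology.localization ρ v 1 x - localMap ι v (s v) ∈ 𝓕 v :=
  (hSC ρ hM S hS 𝓕 𝓖 hle h𝓕 h𝓖).1 (fun v ↦ localMap ι v (s v)) hs fun y hy ↦
    sum_localTatePairingZMod_localMap_localization_eq_zero_of_map_tateDualComap_eq_zero ι inv S s y (hkill y hy)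

/-- **One place at a time.** Under the same hypotheses, for `v₀ ∈ S` and `g ∈ H¹(K_{v₀}, M₀)` with `H¹(ι_{v₀}) g ∈ 𝓖_{v₀}` there is
`x ∈ H¹_𝓖(K, M)` with `loc_{v₀} x − H¹(ι_{v₀}) g ∈ 𝓕_{v₀}` and `loc_v x ∈ 𝓕_v` at every other `v ∈ S` (test family supported at `v₀`).
[cite: Howard2004HeegnerKolyvagin, Thm. 2.1.11 (arXiv:1202.6340 p. 6)] -/
theorem exists_selmer_sub_localMap_mem_single_of_dualPullback_eq_zero {inv : LocalInvariants K n}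
    (hSC : inv.SelmerComplement) (hM : ∀ m : M, n • m = 0) (S : Finset (Place K))
    (hS : ∀ v : HeightOneSpectrum (𝓞 K), (Sum.inr v : Place K) ∉ S →
      ((n : ℕ) : 𝓞 K) ∉ v.asIdeal ∧ GaloisRep.IsUnramifiedAt v ρ)
    {𝓕 𝓖 : SelmerStructure ρ} (hle : 𝓕 ≤ 𝓖) (h𝓕 : 𝓕.IsUnramifiedOutside S) (h𝓖 : 𝓖.IsUnramifiedOutside S)
    {v₀ : Place K} (hv₀ : v₀ ∈ S) (g : galoisCohomology (ρ₀.toLocal v₀) 1) (hg : localMap ι v₀ g ∈ 𝓖 v₀)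
    (hkill : ∀ y ∈ (inv.dualSelmerStructure ρ 𝓕).selmerGroup, galoisCohomology.map (tateDualComap ι) 1 y = 0) :
    ∃ x ∈ 𝓖.selmerGroup, galoisCohomology.localization ρ v₀ 1 x - localMap ι v₀ g ∈ 𝓕 v₀ ∧
      ∀ v ∈ S, v ≠ v₀ → galoisCohomology.localization ρ v 1 x ∈ 𝓕 v := by
  -- the family supported at `v₀`
  set s : Π v : Place K, galoisCohomology (ρ₀.toLocal v) 1 := fun v ↦ if h : v = v₀ then h ▸ g else 0 with hs_def
  have hs₀ : s v₀ = g := by rw [hs_def]; exact dif_pos rfl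
  have hsne : ∀ v, v ≠ v₀ → s v = 0 := fun v hv ↦ by rw [hs_def]; exact dif_neg hv
  have hs : ∀ v ∈ S, localMap ι v (s v) ∈ 𝓖 v := fun v _ ↦ by
    by_cases hv : v = v₀
    · subst hv; rw [hs₀]; exact hg
    · rw [hsne v hv, map_zero]; exact zero_mem _
  obtain ⟨x, hx, hxS⟩ := exists_selmer_sub_localMap_mem_of_dualPullback_eq_zero ρ₀ ρ ι hSC hM S hS hle h𝓕 h𝓖 s hs hkill
  refine ⟨x, hx, ?_, fun v hv hne ↦ ?_⟩
  · have h := hxS v₀ hv₀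
    rwa [hs₀] at h
  · have h := hxS v hv
    rwa [hsne v hne, map_zero, sub_zero] at h

end Surgery

/-! ## §3. The surgery for THE canonical family of local invariant maps (Poitou–Tate is a THEOREM of the tree) -/

section Canonical

variable {K : Type} [Field K] [NumberField K] {M₀ M : Type}
  [AddCommGroup M₀] [TopologicalSpace M₀] [DiscreteTopology M₀] [Finite M₀]
  [AddCommGroup M] [TopologicalSpace M] [DiscreteTopology M] [Finite M]
  (ρ₀ : DiscreteGaloisModule K M₀) (ρ : DiscreteGaloisModule K M) (n : ℕ) [NeZero n]
  (ι : ρ₀.toContRepresentation →ⁱL ρ.toContRepresentation)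

/-- **THE LEVEL-LIFTING SURGERY, UNCONDITIONAL**: `exists_selmer_sub_localMap_mem_of_dualPullback_eq_zero` for THE canonical family
`LocalInvariants.canonical K n` of local invariant maps, whose `SelmerComplement` is the tree's theorem
`selmerComplement_canonical_holds` (Milne I 4.10 (b) / Howard 2.1.11 in the kernel). For every number field `K`, every `n ≥ 1`,
every `M₀ →ι M` with `n • M = 0`, every admissible `S`, every `𝓕 ≤ 𝓖` unramified outside `S`: if the transition `H¹(ι^D)` kills the
canonical dual Selmer group `H¹_{𝓕^*}(K, M^D)` then every family `H¹(ι_v) s_v ∈ 𝓖_v` (`v ∈ S`) is `(loc_v x)_v` modulo `(𝓕_v)_v` for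
some `x ∈ H¹_𝓖(K, M)`. [cite: MilneADT2006, Ch. I, Thm. 4.10 (b)] [cite: Howard2004HeegnerKolyvagin, Thm. 2.1.11 (arXiv:1202.6340 p. 6)]
[cite: JetchevSkinnerWan2017, Prop. 3.3.2 (arXiv:1512.06894 p. 11)] -/
theorem exists_selmer_sub_localMap_mem_canonical_of_dualPullback_eq_zero (hM : ∀ m : M, n • m = 0) (S : Finset (Place K))
    (hS : ∀ v : HeightOneSpectrum (𝓞 K), (Sum.inr v : Place K) ∉ S →
      ((n : ℕ) : 𝓞 K) ∉ v.asIdeal ∧ GaloisRep.IsUnramifiedAt v ρ)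
    {𝓕 𝓖 : SelmerStructure ρ} (hle : 𝓕 ≤ 𝓖) (h𝓕 : 𝓕.IsUnramifiedOutside S) (h𝓖 : 𝓖.IsUnramifiedOutside S)
    (s : Π v : Place K, galoisCohomology (ρ₀.toLocal v) 1) (hs : ∀ v ∈ S, localMap ι v (s v) ∈ 𝓖 v)
    (hkill : ∀ y ∈ ((LocalInvariants.canonical K n).dualSelmerStructure ρ 𝓕).selmerGroup,
      galoisCohomology.map (tateDualComap ι) 1 y = 0) :
    ∃ x ∈ 𝓖.selmerGroup, ∀ v ∈ S, galoisCohomology.localization ρ v 1 x - localMap ι v (s v) ∈ 𝓕 v :=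
  exists_selmer_sub_localMap_mem_of_dualPullback_eq_zero ρ₀ ρ ι (selmerComplement_canonical_holds K n) hM S hS hle h𝓕 h𝓖
    s hs hkill

/-- **Local-kill form for the canonical family**: it suffices that `H¹(ι^D_v)(loc_v y) = 0` at the places `v ∈ S` for every `y` in
the canonical dual Selmer group. [cite: MilneADT2006, Ch. I, Thm. 4.10 (b)] [cite: JetchevSkinnerWan2017, Prop. 3.3.2 (arXiv:1512.06894 p. 11)] -/
theorem exists_selmer_sub_localMap_mem_canonical_of_forall_localMap_tateDualComap_eq_zero (hM : ∀ m : M, n • m = 0)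
    (S : Finset (Place K))
    (hS : ∀ v : HeightOneSpectrum (𝓞 K), (Sum.inr v : Place K) ∉ S →
      ((n : ℕ) : 𝓞 K) ∉ v.asIdeal ∧ GaloisRep.IsUnramifiedAt v ρ)
    {𝓕 𝓖 : SelmerStructure ρ} (hle : 𝓕 ≤ 𝓖) (h𝓕 : 𝓕.IsUnramifiedOutside S) (h𝓖 : 𝓖.IsUnramifiedOutside S)
    (s : Π v : Place K, galoisCohomology (ρ₀.toLocal v) 1) (hs : ∀ v ∈ S, localMap ι v (s v) ∈ 𝓖 v)
    (hkill : ∀ y ∈ ((LocalInvariants.canonical K n).dualSelmerStructure ρ 𝓕).selmerGroup, ∀ v ∈ S,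
      localMap (tateDualComap ι) v (galoisCohomology.localization (ρ.tateDual n) v 1 y) = 0) :
    ∃ x ∈ 𝓖.selmerGroup, ∀ v ∈ S, galoisCohomology.localization ρ v 1 x - localMap ι v (s v) ∈ 𝓕 v :=
  exists_selmer_sub_localMap_mem_of_forall_localMap_tateDualComap_eq_zero ρ₀ ρ ι (selmerComplement_canonical_holds K n) hM S
    hS hle h𝓕 h𝓖 s hs hkill

/-- **One place at a time, canonical family.** [cite: Howard2004HeegnerKolyvagin, Thm. 2.1.11 (arXiv:1202.6340 p. 6)] -/
theorem exists_selmer_sub_localMap_mem_single_canonical_of_dualPullback_eq_zero (hM : ∀ m : M, n • m = 0)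
    (S : Finset (Place K))
    (hS : ∀ v : HeightOneSpectrum (𝓞 K), (Sum.inr v : Place K) ∉ S →
      ((n : ℕ) : 𝓞 K) ∉ v.asIdeal ∧ GaloisRep.IsUnramifiedAt v ρ)
    {𝓕 𝓖 : SelmerStructure ρ} (hle : 𝓕 ≤ 𝓖) (h𝓕 : 𝓕.IsUnramifiedOutside S) (h𝓖 : 𝓖.IsUnramifiedOutside S)
    {v₀ : Place K} (hv₀ : v₀ ∈ S) (g : galoisCohomology (ρ₀.toLocal v₀) 1) (hg : localMap ι v₀ g ∈ 𝓖 v₀)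
    (hkill : ∀ y ∈ ((LocalInvariants.canonical K n).dualSelmerStructure ρ 𝓕).selmerGroup,
      galoisCohomology.map (tateDualComap ι) 1 y = 0) :
    ∃ x ∈ 𝓖.selmerGroup, galoisCohomology.localization ρ v₀ 1 x - localMap ι v₀ g ∈ 𝓕 v₀ ∧
      ∀ v ∈ S, v ≠ v₀ → galoisCohomology.localization ρ v 1 x ∈ 𝓕 v :=
  exists_selmer_sub_localMap_mem_single_of_dualPullback_eq_zero ρ₀ ρ ι (selmerComplement_canonical_holds K n) hM S hS hle h𝓕
    h𝓖 hv₀ g hg hkill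

end Canonical

end Summit.BirchSwinnertonDyer.BirchSwinnertonDyer.Theorems.PrintCf2.ProNullLift

end
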